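import Literature.MathematicalPhysics.QuantumFieldTheory.Balaban1983to89.T4BoundaryRateCollar

/-!
# BoundaryRateWeightedTilt — the boundary-member END faces with a WEIGHTED tilt modulus: the output's own tree decay is carried by
the tilt kernel, so that the slice geometry count is stated with an honest weight (cell `pub-balaban`, T⁴ fan-out,
`HOME/BINDER-OWNERS.md` row NE5, route P3 «boundary-functional member»; ROUND-2 skeleton `t4/skeletons/NE5-t4-ne5-p3.md` §3 L03∕L14,
§7 row B1; lineage t4-ne5-p3 gen 17; typing + bookkeeping only; imports the Literature leaf `T4BoundaryRateCollar` (v1.5.1, hence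
`T4BoundaryRate` v1.6.2) ONLY and modifies nothing of them)

HONEST FRAMING (T4-DAG PAGE 1; identical to the parent's).  The cell's T⁴ target is rung (B)+1: existence AND uniqueness of the
ε → 0 limit of Bałaban's unit-scale averaged loop expectations on a FIXED finite torus — strictly beyond ultraviolet stability,
NOT infinite volume, NOT a mass gap, NOT the Clay problem.  HONEST DEPENDENCY (cell line, verbatim): «continuum YM on T⁴ ⇐
BetaPertH ∧ nine spine estimates (0/9 proved); BetaPertH ⇐ (D1) ∧ (D4) ∧ CAP+tail; G-an2-4 gates asym, D1 and NE2/3/4.»  This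
module asserts NOTHING about Bałaban's objects; every theorem is [folklore] bookkeeping over the parent's hypothesis SHAPES.
`T4BoundaryCarrier.NE5B` is NOT PRINTED and is NOT proved here.

WHY (a located weakness of the lineage's own END faces, found while designing the geometry witness of skeleton row B1).  The
parent's END faces `T4BoundaryRateCollar.ne5B_of_collar` / `ne5B_of_frame` / `ne5B_of_pathFrame` take the tilt modulus with a
CONSTANT bound `hKT : KT X Y ≤ kT` and, consequently, the slice geometry count with UNIT weights,
`hS : SliceCountGrowing G κ (fun _ _ => 1) Mc V`, i.e. `Σ_{Y ∈ parents X, scale Y = j} e^{−κd(Y)} ≤ Mc·V^{scale X − j}·e^{−κd(X)}`.  For an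
output `X` with LARGE tree length `d(X)` and the MANY short older domains inside it as parents (Bałaban's situation: every older
boundary piece localized inside `X` feeds the t-integral of [Balaban1988Convergent] (3.27) p. 271, and [Balaban1987RG1] (0.26)
p. 257 only bounds `Σ_{Y ∋ y} e^{−κd_j(Y)}` PER POINT `y`) the left side grows with the volume of `X` while the right side decays in
`d(X)`: the unit-weight count is then NOT INHABITABLE (kernel witness in the companion module `Support/BoundaryRateSliceGeometry`,
row B1).  WHERE THE MISSING DECAY LIVES (one-run print, located): in the TILT kernel — the term of the localized expansion
(3.44)–(3.47) with localization domain `X` that involves the older piece `Y` is itself bounded *"as in (2.42), with the constant B₀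
replaced by O(p₁(g_k))"* (p. 278), i.e. carries ITS OWN tree decay `e^{−κ′d_{k+1}(X)}` in the OUTPUT's length, with the SURPLUS rate
of the newly created terms, p. 262 *"they have better decay properties, with the number κ replaced, for example, by (1 + 4β)κ"*.
So the honest typing of skeleton leaf L03 is a WEIGHTED bound `KT X Y ≤ kT·u X Y` (`u` = the output-decay weight, e.g.
`u X Y = e^{−κ₁d(X)}` with `κ₁ > κ`), and the honest slice count (leaf L14) is `SliceCountGrowing G κ u Mc V` — the surplus
`e^{−(κ₁ − κ)d(X)}` absorbing the volume of `X` (row B1 shows this two-sidedly in a nested geometry: inhabitable with `V = L` and NOT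
inhabitable with unit weights or without surplus).  This module re-derives the END faces in that form, BY NAME from the parent's
lemmas; the parent's faces are the special case `u ≡ 1`.  Nothing else changes: `OpDisc`, `TiltLip`, `FluctDamped`/`MarginCauchy`,
`GapShape`, `CollarDecay`, the admissibility binders and the regular channel are untouched.

CONTENTS.  §1 `perParentDamped_of_fluct₂` (tilt weight `u` × profile weight `w`); §2 `ne5B_of_fluct₂`, `ne5B_of_layered₂`; §3
`ne5B_of_collar₂`, `ne5B_of_frame₂`, `ne5B_of_pathFrame₂` (the ROUND-2 skeleton's composition C1 in weighted form: binders = the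
parent's with `hKT : KT X Y ≤ kT * u X Y`, `hu0`, and `hS : SliceCountGrowing G κ u Mc V`); §4 the parent's unit-weight face recovered
(`ne5B_of_pathFrame_unit`), so no strength is lost.
Names used — `T4BoundaryRate`: `Generation`, `fluctGeneration` (+ `_parents`, `_K`), `PerParentDamped`, `SliceCountGrowing`,
`EKernelContracts`, `TiltLip`, `FluctDamped`, `FluctChart`, `RepresentsA/B`, `OpDisc`, `GenMap`, `BTable`, `ETable`, `pullB`, `epullB`,
`tabB`, `etabB`, `inputLipB_of_fluct`, `sliceCountGrowing_fluct`, `eKernelContracts_fluct`, `ne5B_of_split`, `LayeredDamped`,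
`profile_of_layered`; `T4BoundaryRateCollar`: `LayerGauge`, `MarginCauchy`, `GapShape`, `CollarDecay`, `layeredSigma`,
`layeredSigma_nonneg`, `layeredDamped_layeredSigma`, `fluctDamped_of_collar`, `CplxFrame`, `FrameChart`, `FrameCore`, `FrameGauge`,
`FrameMargin`, `FramePath`, `FrameAnalytic`, `marginCauchy_of_frame`, `marginCauchy_of_pathFrame`; `T4BoundaryCarrier.NE5B`;
`T4OutputRate.NE5`.  Cell record: skeleton `t4/skeletons/NE5-t4-ne5-p3.md` (v1.1 re-points C1 to `ne5B_of_pathFrame₂`).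
-/

namespace Summit.QuantumFields.BalabanUV.T4Continuum.BoundaryRateWeightedTilt

open Finset
open Literature.MathematicalPhysics.QuantumFieldTheory.Balaban1983to89
open T4OutputRate T4BoundaryCarrier T4BoundaryRate T4BoundaryRateCollar

variable {C : T4BoundaryCarrier.Carriers}

/-! ## §1 Per-parent damping with a weighted tilt modulus -/

/-- **TWO WEIGHTS** [folklore]: a tilt modulus bounded by `kT·u X Y` (the output-decay weight `u`) and a displacement-over-margin factor
damped geometrically with weight `w` give the parent's `PerParentDamped` for the factorised datum with constant `kT·s₀` and the PRODUCT
weight `u·w`. -/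
theorem perParentDamped_of_fluct₂ {G : Generation C} {KT σ u w : C.Dom → C.Dom → ℝ} {ω kT s₀ : ℝ}
    (hKT0 : ∀ X Y, 0 ≤ KT X Y) (hσ0 : ∀ X Y, 0 ≤ σ X Y)
    (hKT : ∀ X : C.Dom, ∀ Y ∈ G.parents X, KT X Y ≤ kT * u X Y)
    (hσ : ∀ X : C.Dom, ∀ Y ∈ G.parents X, σ X Y ≤ s₀ * ω ^ (C.scale X - C.scale Y) * w X Y) :
    PerParentDamped (fluctGeneration G KT σ hKT0 hσ0) ω (kT * s₀) (fun X Y => u X Y * w X Y) := by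
  intro X Y hY
  rw [fluctGeneration_parents] at hY
  rw [fluctGeneration_K]
  have hku : 0 ≤ kT * u X Y := le_trans (hKT0 X Y) (hKT X Y hY)
  calc KT X Y * σ X Y ≤ (kT * u X Y) * (s₀ * ω ^ (C.scale X - C.scale Y) * w X Y) :=
        mul_le_mul (hKT X Y hY) (hσ X Y hY) (hσ0 X Y) hku
    _ = kT * s₀ * ω ^ (C.scale X - C.scale Y) * (u X Y * w X Y) := by ring

/-! ## §2 END faces from the factorised leaves with the weighted tilt modulus -/

/-- **END-TO-END, GEOMETRIC PROFILE, WEIGHTED TILT** [folklore]: the parent's `ne5B_of_fluct` with `hKT : KT X Y ≤ kT·u X Y` and the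
slice count stated for the product weight `u·w`. -/
theorem ne5B_of_fluct₂ {A : Type} {G : Generation C} {ch : FluctChart C A} {ΦA : GenMap C C.BgA} {Φ : GenMap C C.BgB}
    {BA : BFunctional C C.BgA} {BB : BFunctional C C.BgB}
    {EA : Functional C.toCarriers C.BgA} {EB : Functional C.toCarriers C.BgB} {W : Set (ℕ → ℝ)}
    {Adm : (ℕ → ℝ) → BTable C C.BgB → ETable C C.BgB → Prop}
    {κ θ ω kT s₀ Mc V Cop CE lamE : ℝ} {KT σ u w : C.Dom → C.Dom → ℝ}
    (hRA : RepresentsA ΦA BA EA W) (hRB : RepresentsB Φ BB EB W)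
    (hT : TiltLip G ch Φ W κ Adm KT) (hF : FluctDamped G ch W κ Adm σ)
    (hKT0 : ∀ X Y, 0 ≤ KT X Y) (hσ0 : ∀ X Y, 0 ≤ σ X Y)
    (hKT : ∀ X : C.Dom, ∀ Y ∈ G.parents X, KT X Y ≤ kT * u X Y)
    (hσ : ∀ X : C.Dom, ∀ Y ∈ G.parents X, σ X Y ≤ s₀ * ω ^ (C.scale X - C.scale Y) * w X Y)
    (hOD : OpDisc ΦA Φ BA EA W κ θ Cop)
    (hadmA : ∀ g ∈ W, Adm g (pullB BA g) (epullB EA g)) (hadmB : ∀ g ∈ W, Adm g (tabB BB g) (etabB EB g))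
    (hS : SliceCountGrowing G κ (fun X Y => u X Y * w X Y) Mc V)
    (hKE : EKernelContracts G κ θ lamE) (hE : NE5 EA EB W κ θ CE)
    (hθ : 0 < θ) (hω : 0 ≤ ω) (hV : 0 ≤ V) (hωθ : ω * V < θ) (hkT : 0 ≤ kT) (hs₀ : 0 ≤ s₀) (hMc : 0 ≤ Mc)
    (hsmall : kT * s₀ * Mc * (ω * V / θ) / (1 - ω * V / θ) < 1) (hCop : 0 ≤ Cop) (hCE : 0 ≤ CE) (hlamE : 0 ≤ lamE) :
    NE5B BA BB W κ θ ((Cop + lamE * CE) / (1 - kT * s₀ * Mc * (ω * V / θ) / (1 - ω * V / θ))) :=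
  ne5B_of_split (G := fluctGeneration G KT σ hKT0 hσ0) hRA hRB (inputLipB_of_fluct hT hF hKT0 hσ0) hOD hadmA hadmB
    (perParentDamped_of_fluct₂ hKT0 hσ0 hKT hσ) (sliceCountGrowing_fluct hS) (eKernelContracts_fluct hKE) hE
    hθ hω hV hωθ (mul_nonneg hkT hs₀) hMc hsmall hCop hCE hlamE

/-- **END-TO-END, LAYERED PROFILE, WEIGHTED TILT** [folklore]: `ne5B_of_fluct₂` with the layered profile of `σ` (`profile_of_layered`):
damping ratio `δ`, constant `kT·(s₀/(1 − δρ))`, weight `u·w`. -/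
theorem ne5B_of_layered₂ {A : Type} {G : Generation C} {ch : FluctChart C A} {ΦA : GenMap C C.BgA} {Φ : GenMap C C.BgB}
    {BA : BFunctional C C.BgA} {BB : BFunctional C C.BgB}
    {EA : Functional C.toCarriers C.BgA} {EB : Functional C.toCarriers C.BgB} {W : Set (ℕ → ℝ)}
    {Adm : (ℕ → ℝ) → BTable C C.BgB → ETable C C.BgB → Prop}
    {κ θ δ ρ kT s₀ Mc V Cop CE lamE : ℝ} {KT σ u w : C.Dom → C.Dom → ℝ}
    (hRA : RepresentsA ΦA BA EA W) (hRB : RepresentsB Φ BB EB W)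
    (hT : TiltLip G ch Φ W κ Adm KT) (hF : FluctDamped G ch W κ Adm σ)
    (hKT0 : ∀ X Y, 0 ≤ KT X Y) (hσ0 : ∀ X Y, 0 ≤ σ X Y)
    (hKT : ∀ X : C.Dom, ∀ Y ∈ G.parents X, KT X Y ≤ kT * u X Y)
    (hLay : LayeredDamped G σ s₀ δ ρ w)
    (hOD : OpDisc ΦA Φ BA EA W κ θ Cop)
    (hadmA : ∀ g ∈ W, Adm g (pullB BA g) (epullB EA g)) (hadmB : ∀ g ∈ W, Adm g (tabB BB g) (etabB EB g))
    (hw : ∀ X : C.Dom, ∀ Y ∈ G.parents X, 0 ≤ w X Y) (hS : SliceCountGrowing G κ (fun X Y => u X Y * w X Y) Mc V)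
    (hKE : EKernelContracts G κ θ lamE) (hE : NE5 EA EB W κ θ CE)
    (hθ : 0 < θ) (hδ : 0 ≤ δ) (hρ : 0 ≤ ρ) (hδρ : δ * ρ < 1) (hV : 0 ≤ V) (hδθ : δ * V < θ) (hkT : 0 ≤ kT)
    (hs₀ : 0 ≤ s₀) (hMc : 0 ≤ Mc)
    (hsmall : kT * (s₀ / (1 - δ * ρ)) * Mc * (δ * V / θ) / (1 - δ * V / θ) < 1)
    (hCop : 0 ≤ Cop) (hCE : 0 ≤ CE) (hlamE : 0 ≤ lamE) :
    NE5B BA BB W κ θ ((Cop + lamE * CE) / (1 - kT * (s₀ / (1 - δ * ρ)) * Mc * (δ * V / θ) / (1 - δ * V / θ))) :=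
  ne5B_of_fluct₂ hRA hRB hT hF hKT0 hσ0 hKT (profile_of_layered hs₀ hδ hρ hδρ hw hLay) hOD hadmA hadmB hS hKE hE
    hθ hδ hV hδθ hkT (div_nonneg hs₀ (by linarith)) hMc hsmall hCop hCE hlamE

/-! ## §3 END faces from the collar ∕ frame ∕ path-frame shapes with the weighted tilt modulus -/

/-- The slice count with the tilt weight alone is the slice count with the product weight `u·1`. [folklore] -/
theorem sliceCountGrowing_mul_one {G : Generation C} {κ Mc V : ℝ} {u : C.Dom → C.Dom → ℝ}
    (hS : SliceCountGrowing G κ u Mc V) : SliceCountGrowing G κ (fun X Y => u X Y * (fun _ _ => (1 : ℝ)) X Y) Mc V := by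
  intro X j hj
  simpa using hS X j hj

/-- **END-TO-END FROM THE THREE SHAPES, WEIGHTED TILT** [folklore]: the parent's `ne5B_of_collar` with `hKT : KT X Y ≤ kT·u X Y` and
`hS : SliceCountGrowing G κ u Mc V` — `σ = layeredSigma (c₀ε/g₀) δ ρ` keeps unit profile weight, the output decay sits in `u`. -/
theorem ne5B_of_collar₂ {A : Type} {G : Generation C} {ch : FluctChart C A} {ΦA : GenMap C C.BgA} {Φ : GenMap C C.BgB}
    {BA : BFunctional C C.BgA} {BB : BFunctional C C.BgB}
    {EA : Functional C.toCarriers C.BgA} {EB : Functional C.toCarriers C.BgB} {W : Set (ℕ → ℝ)}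
    {Adm : (ℕ → ℝ) → BTable C C.BgB → ETable C C.BgB → Prop} {AdmT : (ℕ → ℝ) → BTable C C.BgB → Prop}
    {lg : LayerGauge C} {gap : C.Dom → C.Dom → ℕ → ℝ}
    {κ θ δ ρ kT c₀ g₀ ε Mc V Cop CE lamE : ℝ} {KT u : C.Dom → C.Dom → ℝ}
    (hRA : RepresentsA ΦA BA EA W) (hRB : RepresentsB Φ BB EB W)
    (hT : TiltLip G ch Φ W κ Adm KT)
    (hcl : ∀ g ∈ W, ∀ (f f' : BTable C C.BgB) (e e' : ETable C C.BgB), Adm g f e → Adm g f' e' → AdmT g (f - f'))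
    (hMC : MarginCauchy G ch W κ AdmT lg gap c₀) (hGap : GapShape G gap g₀ ρ) (hCD : CollarDecay ch lg ε δ)
    (hKT0 : ∀ X Y, 0 ≤ KT X Y) (hKT : ∀ X : C.Dom, ∀ Y ∈ G.parents X, KT X Y ≤ kT * u X Y)
    (hOD : OpDisc ΦA Φ BA EA W κ θ Cop)
    (hadmA : ∀ g ∈ W, Adm g (pullB BA g) (epullB EA g)) (hadmB : ∀ g ∈ W, Adm g (tabB BB g) (etabB EB g))
    (hS : SliceCountGrowing G κ u Mc V)
    (hKE : EKernelContracts G κ θ lamE) (hE : NE5 EA EB W κ θ CE)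
    (hθ : 0 < θ) (hc₀ : 0 ≤ c₀) (hg₀ : 0 < g₀) (hρ : 0 ≤ ρ) (hε : 0 ≤ ε) (hδ : 0 ≤ δ) (hδ1 : δ ≤ 1) (hδρ : δ * ρ < 1)
    (h2ε : 2 * ε ≤ g₀) (hV : 0 ≤ V) (hδθ : δ * V < θ) (hkT : 0 ≤ kT) (hMc : 0 ≤ Mc)
    (hsmall : kT * ((c₀ * ε / g₀) / (1 - δ * ρ)) * Mc * (δ * V / θ) / (1 - δ * V / θ) < 1)
    (hCop : 0 ≤ Cop) (hCE : 0 ≤ CE) (hlamE : 0 ≤ lamE) :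
    NE5B BA BB W κ θ
      ((Cop + lamE * CE) / (1 - kT * ((c₀ * ε / g₀) / (1 - δ * ρ)) * Mc * (δ * V / θ) / (1 - δ * V / θ))) :=
  have hs₀ : 0 ≤ c₀ * ε / g₀ := div_nonneg (mul_nonneg hc₀ hε) hg₀.le
  ne5B_of_layered₂ hRA hRB hT (fluctDamped_of_collar hcl hMC hGap hCD hc₀ hg₀ hρ hε hδ hδ1 hδρ.le h2ε) hKT0
    (layeredSigma_nonneg hs₀ hδ hρ) hKT (layeredDamped_layeredSigma G (c₀ * ε / g₀) δ ρ) hOD hadmA hadmB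
    (fun _ _ _ => zero_le_one) (sliceCountGrowing_mul_one hS) hKE hE hθ hδ hρ hδρ hV hδθ hkT hs₀ hMc hsmall hCop hCE hlamE

/-- **END-TO-END FROM THE ANALYTIC FRAME, WEIGHTED TILT** (`c₀ = 4`) [folklore]. -/
theorem ne5B_of_frame₂ {A : Type} {E : Type*} [NormedAddCommGroup E] [NormedSpace ℂ E]
    {F : CplxFrame C A E} {G : Generation C} {ch : FluctChart C A} {ΦA : GenMap C C.BgA}
    {Φ : GenMap C C.BgB} {BA : BFunctional C C.BgA} {BB : BFunctional C C.BgB}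
    {EA : Functional C.toCarriers C.BgA} {EB : Functional C.toCarriers C.BgB} {W : Set (ℕ → ℝ)}
    {Adm : (ℕ → ℝ) → BTable C C.BgB → ETable C C.BgB → Prop} {AdmT : (ℕ → ℝ) → BTable C C.BgB → Prop}
    {lg : LayerGauge C} {gap : C.Dom → C.Dom → ℕ → ℝ}
    {κ θ δ ρ kT g₀ ε Mc V Cop CE lamE : ℝ} {KT u : C.Dom → C.Dom → ℝ}
    (hRA : RepresentsA ΦA BA EA W) (hRB : RepresentsB Φ BB EB W)
    (hT : TiltLip G ch Φ W κ Adm KT)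
    (hcl : ∀ g ∈ W, ∀ (f f' : BTable C C.BgB) (e e' : ETable C C.BgB), Adm g f e → Adm g f' e' → AdmT g (f - f'))
    (hCh : FrameChart F ch) (hCo : FrameCore F ch) (hG : FrameGauge F ch lg) (hM : FrameMargin F G ch gap)
    (hAn : FrameAnalytic F W AdmT) (hGap : GapShape G gap g₀ ρ) (hCD : CollarDecay ch lg ε δ)
    (hKT0 : ∀ X Y, 0 ≤ KT X Y) (hKT : ∀ X : C.Dom, ∀ Y ∈ G.parents X, KT X Y ≤ kT * u X Y)
    (hOD : OpDisc ΦA Φ BA EA W κ θ Cop)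
    (hadmA : ∀ g ∈ W, Adm g (pullB BA g) (epullB EA g)) (hadmB : ∀ g ∈ W, Adm g (tabB BB g) (etabB EB g))
    (hS : SliceCountGrowing G κ u Mc V)
    (hKE : EKernelContracts G κ θ lamE) (hE : NE5 EA EB W κ θ CE)
    (hθ : 0 < θ) (hg₀ : 0 < g₀) (hρ : 0 ≤ ρ) (hε : 0 ≤ ε) (hδ : 0 ≤ δ) (hδ1 : δ ≤ 1) (hδρ : δ * ρ < 1)
    (h2ε : 2 * ε ≤ g₀) (hV : 0 ≤ V) (hδθ : δ * V < θ) (hkT : 0 ≤ kT) (hMc : 0 ≤ Mc)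
    (hsmall : kT * ((4 * ε / g₀) / (1 - δ * ρ)) * Mc * (δ * V / θ) / (1 - δ * V / θ) < 1)
    (hCop : 0 ≤ Cop) (hCE : 0 ≤ CE) (hlamE : 0 ≤ lamE) :
    NE5B BA BB W κ θ
      ((Cop + lamE * CE) / (1 - kT * ((4 * ε / g₀) / (1 - δ * ρ)) * Mc * (δ * V / θ) / (1 - δ * V / θ))) :=
  ne5B_of_collar₂ hRA hRB hT hcl (marginCauchy_of_frame hCh hCo hG hM hAn fun X Y hY j hj => (hGap X Y hY j hj).1)
    hGap hCD hKT0 hKT hOD hadmA hadmB hS hKE hE hθ (by norm_num) hg₀ hρ hε hδ hδ1 hδρ h2ε hV hδθ hkT hMc hsmall hCop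
    hCE hlamE

/-- **END-TO-END FROM THE PATH FRAME, WEIGHTED TILT** (`c₀ = 2`) [folklore] — the ROUND-2 skeleton's composition C1 in its honest
form: the binders are those of the parent's `ne5B_of_pathFrame` except that the tilt modulus is bounded by `kT·u X Y` and the slice
geometry count is stated with the weight `u`. -/
theorem ne5B_of_pathFrame₂ {A : Type} {E : Type*} [NormedAddCommGroup E] [NormedSpace ℂ E]
    {F : CplxFrame C A E} {G : Generation C} {ch : FluctChart C A} {ΦA : GenMap C C.BgA}
    {Φ : GenMap C C.BgB} {BA : BFunctional C C.BgA} {BB : BFunctional C C.BgB}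
    {EA : Functional C.toCarriers C.BgA} {EB : Functional C.toCarriers C.BgB} {W : Set (ℕ → ℝ)}
    {Adm : (ℕ → ℝ) → BTable C C.BgB → ETable C C.BgB → Prop} {AdmT : (ℕ → ℝ) → BTable C C.BgB → Prop}
    {lg : LayerGauge C} {gap : C.Dom → C.Dom → ℕ → ℝ}
    {κ θ δ ρ kT g₀ ε Mc V Cop CE lamE : ℝ} {KT u : C.Dom → C.Dom → ℝ}
    (hRA : RepresentsA ΦA BA EA W) (hRB : RepresentsB Φ BB EB W)
    (hT : TiltLip G ch Φ W κ Adm KT)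
    (hcl : ∀ g ∈ W, ∀ (f f' : BTable C C.BgB) (e e' : ETable C C.BgB), Adm g f e → Adm g f' e' → AdmT g (f - f'))
    (hCh : FrameChart F ch) (hCo : FrameCore F ch) (hP : FramePath F G ch lg gap) (hAn : FrameAnalytic F W AdmT)
    (hGap : GapShape G gap g₀ ρ) (hCD : CollarDecay ch lg ε δ)
    (hKT0 : ∀ X Y, 0 ≤ KT X Y) (hKT : ∀ X : C.Dom, ∀ Y ∈ G.parents X, KT X Y ≤ kT * u X Y)
    (hOD : OpDisc ΦA Φ BA EA W κ θ Cop)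
    (hadmA : ∀ g ∈ W, Adm g (pullB BA g) (epullB EA g)) (hadmB : ∀ g ∈ W, Adm g (tabB BB g) (etabB EB g))
    (hS : SliceCountGrowing G κ u Mc V)
    (hKE : EKernelContracts G κ θ lamE) (hE : NE5 EA EB W κ θ CE)
    (hθ : 0 < θ) (hg₀ : 0 < g₀) (hρ : 0 ≤ ρ) (hε : 0 ≤ ε) (hδ : 0 ≤ δ) (hδ1 : δ ≤ 1) (hδρ : δ * ρ < 1)
    (h2ε : 2 * ε ≤ g₀) (hV : 0 ≤ V) (hδθ : δ * V < θ) (hkT : 0 ≤ kT) (hMc : 0 ≤ Mc)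
    (hsmall : kT * ((2 * ε / g₀) / (1 - δ * ρ)) * Mc * (δ * V / θ) / (1 - δ * V / θ) < 1)
    (hCop : 0 ≤ Cop) (hCE : 0 ≤ CE) (hlamE : 0 ≤ lamE) :
    NE5B BA BB W κ θ
      ((Cop + lamE * CE) / (1 - kT * ((2 * ε / g₀) / (1 - δ * ρ)) * Mc * (δ * V / θ) / (1 - δ * V / θ))) :=
  ne5B_of_collar₂ hRA hRB hT hcl (marginCauchy_of_pathFrame hCh hCo hP hAn fun X Y hY j hj => (hGap X Y hY j hj).1)
    hGap hCD hKT0 hKT hOD hadmA hadmB hS hKE hE hθ (by norm_num) hg₀ hρ hε hδ hδ1 hδρ h2ε hV hδθ hkT hMc hsmall hCop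
    hCE hlamE

/-! ## §4 No strength lost: the parent's unit-weight face is the case `u ≡ 1` -/

/-- The parent's `ne5B_of_pathFrame` recovered from `ne5B_of_pathFrame₂` with `u ≡ 1`. [folklore] -/
theorem ne5B_of_pathFrame_unit {A : Type} {E : Type*} [NormedAddCommGroup E] [NormedSpace ℂ E]
    {F : CplxFrame C A E} {G : Generation C} {ch : FluctChart C A} {ΦA : GenMap C C.BgA}
    {Φ : GenMap C C.BgB} {BA : BFunctional C C.BgA} {BB : BFunctional C C.BgB}
    {EA : Functional C.toCarriers C.BgA} {EB : Functional C.toCarriers C.BgB} {W : Set (ℕ → ℝ)}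
    {Adm : (ℕ → ℝ) → BTable C C.BgB → ETable C C.BgB → Prop} {AdmT : (ℕ → ℝ) → BTable C C.BgB → Prop}
    {lg : LayerGauge C} {gap : C.Dom → C.Dom → ℕ → ℝ}
    {κ θ δ ρ kT g₀ ε Mc V Cop CE lamE : ℝ} {KT : C.Dom → C.Dom → ℝ}
    (hRA : RepresentsA ΦA BA EA W) (hRB : RepresentsB Φ BB EB W)
    (hT : TiltLip G ch Φ W κ Adm KT)
    (hcl : ∀ g ∈ W, ∀ (f f' : BTable C C.BgB) (e e' : ETable C C.BgB), Adm g f e → Adm g f' e' → AdmT g (f - f'))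
    (hCh : FrameChart F ch) (hCo : FrameCore F ch) (hP : FramePath F G ch lg gap) (hAn : FrameAnalytic F W AdmT)
    (hGap : GapShape G gap g₀ ρ) (hCD : CollarDecay ch lg ε δ)
    (hKT0 : ∀ X Y, 0 ≤ KT X Y) (hKT : ∀ X : C.Dom, ∀ Y ∈ G.parents X, KT X Y ≤ kT)
    (hOD : OpDisc ΦA Φ BA EA W κ θ Cop)
    (hadmA : ∀ g ∈ W, Adm g (pullB BA g) (epullB EA g)) (hadmB : ∀ g ∈ W, Adm g (tabB BB g) (etabB EB g))
    (hS : SliceCountGrowing G κ (fun _ _ => 1) Mc V)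
    (hKE : EKernelContracts G κ θ lamE) (hE : NE5 EA EB W κ θ CE)
    (hθ : 0 < θ) (hg₀ : 0 < g₀) (hρ : 0 ≤ ρ) (hε : 0 ≤ ε) (hδ : 0 ≤ δ) (hδ1 : δ ≤ 1) (hδρ : δ * ρ < 1)
    (h2ε : 2 * ε ≤ g₀) (hV : 0 ≤ V) (hδθ : δ * V < θ) (hkT : 0 ≤ kT) (hMc : 0 ≤ Mc)
    (hsmall : kT * ((2 * ε / g₀) / (1 - δ * ρ)) * Mc * (δ * V / θ) / (1 - δ * V / θ) < 1)
    (hCop : 0 ≤ Cop) (hCE : 0 ≤ CE) (hlamE : 0 ≤ lamE) :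
    NE5B BA BB W κ θ
      ((Cop + lamE * CE) / (1 - kT * ((2 * ε / g₀) / (1 - δ * ρ)) * Mc * (δ * V / θ) / (1 - δ * V / θ))) :=
  ne5B_of_pathFrame₂ (u := fun _ _ => 1) hRA hRB hT hcl hCh hCo hP hAn hGap hCD hKT0
    (fun X Y hY => by simpa using hKT X Y hY) hOD hadmA hadmB hS hKE hE hθ hg₀ hρ hε hδ hδ1 hδρ h2ε hV hδθ hkT hMc
    hsmall hCop hCE hlamE

end Summit.QuantumFields.BalabanUV.T4Continuum.BoundaryRateWeightedTilt
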